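import Summits.CriticalPhenomena.PercolationContinuityZ3.Theorems.PercNearOneGluingNoHeavyLowerTailSahiMixtureFourAtoms

/-!
# H-MIX(4), infrastructure II: canonical form of the irredundant three-slot cells of four events, transport along symmetries, and the
# assembly of the hereditary mixture statement for four events from the CANONICAL three-slot cells and the three-of-four cell

Support file of the one-cut programme (crux `NoHeavyLowerTail`, stmt-CriticalPhenomena-4575; cell `prim-masterthm`, seat P3, gen 7;
`run/shared/lean/prim/prim-masterthm/prim-masterthm-p3/HIERARCHY.md` §13–§14).  `…SahiMixtureHMixFour.hereditaryMixture_four_of_cells` reduced H-MIX(4)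
to the generic three-slot cell GC(3) and the three-of-four cell; GC(3) is FALSE (`…SahiMixtureHereditaryRefutation`), but only its `n = 4`
INSTANCES are needed.  This file organises them:
* `Irredundant.canon_three_four` — every irredundant triple of index sets `K_j ⊆ [4]` is, up to a permutation `π` of the events and `τ` of the slots,
  one of the four canonical triples `canonK k` (`k = 0..3`): `({0},{1},{2})`, `({0},{1},{2,3})`, `({0},{1,3},{2,3})`, `({0,3},{1,3},{2,3})`
  (private elements are distinct, the fourth element is shared by the last `k` slots);
* `bernsteinPos_threeSlot_transport` — a three-slot cell is invariant under relabelling events and slots;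
* `CanonThreeSlotCells k` — the sixteen cells (one per `F`) of canonical type `k`, as a `Prop` (proved type by type in `…SahiMixtureFourCellsK*`,
  by replaying ttrl cp-mix's hereditary certificates and by the plain-cell lemma);
* **`hereditaryMixture_four_of_canonCells`** — `(∀ k, CanonThreeSlotCells k) → OrThreeOfFourCell →` H-MIX for every hereditarily all-orders-positive
  quadruple, every `F`, every row of the ∩-closed family of the mixed events.
HONEST FRAMING: a reorganisation of the finite problem; the two displayed hypotheses are discharged in the companion files. [this work]
-/

noncomputable section

open scoped Classical

namespace Summit.CriticalPhenomena.PercolationContinuityZ3.Theorems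

open Finset Function
open Literature.Combinatorics.Sahi2008
open Literature.Probability.Percolation.DecisionTree (ind ind_of_mem ind_of_not_mem ind_nonneg)

namespace SahiMixture

/-! ### Canonical triples of index sets -/

/-- The four canonical irredundant triples of index sets in `[4]`: slot `j` is `{j}`, with the shared element `3` adjoined to the last `k` slots.
[this work] -/
def canonK : Fin 4 → Fin 3 → Finset (Fin 4) :=
  ![![{0}, {1}, {2}], ![{0}, {1}, {2, 3}], ![{0}, {1, 3}, {2, 3}], ![{0, 3}, {1, 3}, {2, 3}]]

/-- `canonK 0 = ({0},{1},{2})`. [this work] -/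
theorem canonK_zero : canonK 0 = ![{0}, {1}, {2}] := rfl
/-- `canonK 1 = ({0},{1},{2,3})`. [this work] -/
theorem canonK_one : canonK 1 = ![{0}, {1}, {2, 3}] := rfl
/-- `canonK 2 = ({0},{1,3},{2,3})`. [this work] -/
theorem canonK_two : canonK 2 = ![{0}, {1, 3}, {2, 3}] := rfl
/-- `canonK 3 = ({0,3},{1,3},{2,3})`. [this work] -/
theorem canonK_three : canonK 3 = ![{0, 3}, {1, 3}, {2, 3}] := rfl

/-- Each canonical slot is its private element, plus `3` when flagged. [this work] -/
theorem canonK_eq_ite (k : Fin 4) (j : Fin 3) :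
    canonK k j = if (3 : Fin 4) ∈ canonK k j then {Fin.castSucc j, 3} else {Fin.castSucc j} := by
  revert k j; decide

/-- Every flag pattern on three slots is a slot permutation of a canonical one ("flags last"). [folklore] -/
theorem exists_perm_flags_canon (ε : Fin 3 → Bool) :
    ∃ (τ : Equiv.Perm (Fin 3)) (k : Fin 4), ∀ j, ε (τ j) = decide ((3 : Fin 4) ∈ canonK k j) := by
  revert ε; decide

/-- **Canonical form of irredundant triples in `[4]`.**  If each of three index sets `K_j ⊆ [4]` keeps a private element, there are a permutation `π`
of `[4]`, a permutation `τ` of the slots and a type `k` with `K_{τ j} = π(canonK k j)` for all `j`. [this work] -/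
theorem Irredundant.canon_three_four {K : Fin 3 → Finset (Fin 4)} (hK : Irredundant K) :
    ∃ (π : Equiv.Perm (Fin 4)) (τ : Equiv.Perm (Fin 3)) (k : Fin 4), ∀ j, K (τ j) = (canonK k j).image π := by
  -- private elements
  have hex : ∀ a : Fin 3, ∃ i : Fin 4, i ∈ K a ∧ i ∉ ((univ : Finset (Fin 3)).erase a).biUnion K := fun a => by
    simpa [Finset.subset_iff] using hK a
  choose f hf using hex
  have hfK : ∀ a b, a ≠ b → f a ∉ K b := fun a b hab h =>
    (hf a).2 (Finset.mem_biUnion.2 ⟨b, Finset.mem_erase.2 ⟨Ne.symm hab, Finset.mem_univ b⟩, h⟩)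
  have hinj : Injective f := by
    intro a b hab
    by_contra hne
    exact hfK a b hne (hab ▸ (hf b).1)
  -- the fourth element
  obtain ⟨d, -, hd⟩ : ∃ d, d ∈ (univ : Finset (Fin 4)) ∧ d ∉ univ.image f :=
    Finset.exists_mem_notMem_of_card_lt_card (by rw [Finset.card_image_of_injective _ hinj]; simp)
  have hdf : ∀ a, f a ≠ d := fun a h => hd (Finset.mem_image.2 ⟨a, Finset.mem_univ a, h⟩)
  -- every index is `d` or some private element
  have hcover : ∀ i : Fin 4, i = d ∨ ∃ a, f a = i := by
    have hcard : (insert d (univ.image f)).card = Fintype.card (Fin 4) := by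
      rw [Finset.card_insert_of_notMem hd, Finset.card_image_of_injective _ hinj]; simp
    have huniv := Finset.eq_univ_of_card _ hcard
    intro i
    have hi : i ∈ insert d (univ.image f) := huniv ▸ Finset.mem_univ i
    rcases Finset.mem_insert.1 hi with h | h
    · exact Or.inl h
    · obtain ⟨a, -, ha⟩ := Finset.mem_image.1 h
      exact Or.inr ⟨a, ha⟩
  -- hence `K a = {f a} ∪ [d ∈ K a]·{d}`
  have hKeq : ∀ a, K a = if d ∈ K a then {f a, d} else {f a} := by
    intro a
    ext i
    constructor
    · intro hi
      rcases hcover i with rfl | ⟨b, rfl⟩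
      · rw [if_pos hi]; simp
      · by_cases hab : b = a
        · subst hab; split_ifs <;> simp
        · exact absurd hi (hfK b a hab)
    · intro hi
      split_ifs at hi with hdm
      · rcases Finset.mem_insert.1 hi with rfl | hi'
        · exact (hf a).1
        · rw [Finset.mem_singleton.1 hi']; exact hdm
      · rw [Finset.mem_singleton.1 hi]; exact (hf a).1
  -- sort the flags `[d ∈ K a]`
  obtain ⟨τ, k, hτ⟩ := exists_perm_flags_canon (fun a => decide (d ∈ K a))
  -- the permutation: private element of slot `τ j` ↦ `j`... i.e. `π j = f (τ j)` for `j < 3`, `π 3 = d`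
  let g : Fin 4 → Fin 4 := fun i => if h : (i : ℕ) < 3 then f (τ ⟨i, h⟩) else d
  have hg3 : g 3 = d := by simp [g]
  have hgc : ∀ j : Fin 3, g (Fin.castSucc j) = f (τ j) := by
    intro j
    have hj : ((Fin.castSucc j : Fin 4) : ℕ) < 3 := by simp [j.isLt]
    simp only [g, dif_pos hj]
    congr 2
  have hginj : Injective g := by
    intro i i' h
    by_cases hi : (i : ℕ) < 3 <;> by_cases hi' : (i' : ℕ) < 3
    · simp only [g, dif_pos hi, dif_pos hi'] at h
      have := τ.injective (hinj h)
      exact Fin.ext (by simpa using congrArg Fin.val this)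
    · simp only [g, dif_pos hi, dif_neg hi'] at h; exact absurd h (hdf _)
    · simp only [g, dif_neg hi, dif_pos hi'] at h; exact absurd h.symm (hdf _)
    · exact Fin.ext (by omega)
  let π : Equiv.Perm (Fin 4) := Equiv.ofBijective g ((Fintype.bijective_iff_injective_and_card g).2 ⟨hginj, rfl⟩)
  refine ⟨π, τ, k, fun j => ?_⟩
  have hflag : (d ∈ K (τ j)) ↔ ((3 : Fin 4) ∈ canonK k j) := by
    have := hτ j
    simpa using this
  rw [hKeq (τ j), canonK_eq_ite k j]
  by_cases h3 : (3 : Fin 4) ∈ canonK k j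
  · rw [if_pos (hflag.2 h3), if_pos h3, Finset.image_insert, Finset.image_singleton]
    simp only [π, Equiv.ofBijective_apply, hgc, hg3]
  · rw [if_neg (fun h => h3 (hflag.1 h)), if_neg h3, Finset.image_singleton]
    simp only [π, Equiv.ofBijective_apply, hgc]

/-! ### Transport of three-slot cells along symmetries -/

section Transport

variable {α : Type*} [Fintype α] {μ : α → ℝ} (A : Fin 4 → Set α) (F : Fin 4 → Bool)

omit [Fintype α] in
/-- Relabelling events inside a member of the ∩-closed family of the mixed events. [this work] -/
theorem biInter_orCoin_image (π : Equiv.Perm (Fin 4)) (L : Finset (Fin 4)) :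
    (⋂ i ∈ L.image π, orCoin (A i) (F i)) = ⋂ i ∈ L, orCoin (A (π i)) (F (π i)) :=
  Finset.set_biInter_finset_image

/-- **Transport**: a three-slot cell of `(A, F)` over index sets `K` equals the cell of the relabelled pair `(A ∘ π, F ∘ π)` over `K'` whenever
`K (τ j) = π(K' j)`; in particular Bernstein positivity transfers. [this work] -/
theorem bernsteinPos_threeSlot_transport (π : Equiv.Perm (Fin 4)) (τ : Equiv.Perm (Fin 3)) (K K' : Fin 3 → Finset (Fin 4))
    (hK : ∀ j, K (τ j) = (K' j).image π)
    (h : BernsteinPos 3 (fun h => sahiE (coinWeight μ h) 3 (fun j => ind (⋂ i ∈ K' j, orCoin (A (π i)) (F (π i)))))) :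
    BernsteinPos 3 (fun h => sahiE (coinWeight μ h) 3 (fun j => ind (⋂ i ∈ K j, orCoin (A i) (F i)))) := by
  refine h.congr fun h _ _ => ?_
  rw [← sahiE_comp_perm (coinWeight μ h) 3 τ (fun j => ind (⋂ i ∈ K j, orCoin (A i) (F i)))]
  congr 1
  funext j
  show ind (⋂ i ∈ K (τ j), orCoin (A i) (F i)) = ind (⋂ i ∈ K' j, orCoin (A (π i)) (F (π i)))
  rw [hK j, biInter_orCoin_image]

end Transport

/-! ### The canonical cells as a `Prop`, the dispatcher, and the assembly -/

/-- **The sixteen three-slot cells of canonical type `k`** (one per `F ⊆ [4]`): for every probability weight and every hereditarily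
all-orders-positive quadruple, `h ↦ E_3(μ⊗coin(h); (1_{⋂_{i ∈ canonK k j}(A_i ∪ [F i]·H)})_j)` is Bernstein-positive of degree `3`.  Proved for
`k = 0,1,2,3` in `…SahiMixtureFourCellsK*` (certificate replay); stated here as the interface of the assembly. [this work] -/
def CanonThreeSlotCells (k : Fin 4) : Prop :=
  ∀ (α : Type) [Fintype α] (μ : α → ℝ), (∀ a, 0 ≤ μ a) → ∑ a, μ a = 1 →
    ∀ (A : Fin 4 → Set α), HereditaryAllOrders μ A → ∀ (F : Fin 4 → Bool),
      BernsteinPos 3 (fun h => sahiE (coinWeight μ h) 3 (fun j => ind (⋂ i ∈ canonK k j, orCoin (A i) (F i))))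

section Assembly

variable {α : Type} [Fintype α] {μ : α → ℝ} (hμ : ∀ a, 0 ≤ μ a) (hμ1 : ∑ a, μ a = 1)
include hμ hμ1

/-- **Dispatcher**: the canonical cells give every irredundant three-slot cell (canonical form + transport + relabelled heredity). [this work] -/
theorem bernsteinPos_threeSlot_of_canon (hc : ∀ k, CanonThreeSlotCells k) (A : Fin 4 → Set α) (hA : HereditaryAllOrders μ A)
    (F : Fin 4 → Bool) (K : Fin 3 → Finset (Fin 4)) (hK : Irredundant K) :
    BernsteinPos 3 (fun h => sahiE (coinWeight μ h) 3 (fun j => ind (⋂ i ∈ K j, orCoin (A i) (F i)))) := by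
  obtain ⟨π, τ, k, hKc⟩ := hK.canon_three_four
  have hA' : HereditaryAllOrders μ (fun i => A (π i)) := by
    have := hA.comp (fun j : Fin 4 => ({π j} : Finset (Fin 4)))
    simpa only [Finset.set_biInter_singleton] using this
  exact bernsteinPos_threeSlot_transport A F π τ K (canonK k) hKc (hc k α μ hμ hμ1 _ hA' (fun i => F (π i)))

/-- **H-MIX FOR FOUR EVENTS FROM THE CANONICAL THREE-SLOT CELLS AND THE THREE-OF-FOUR CELL.**  Same assembly as
`hereditaryMixture_four_of_cells`, with the (false in general) generic cell GC(3) replaced by its `n = 4` instances: uncovered rows only, irredundant,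
`m ≤ 4`; `m = 4` the singleton cells (`bernsteinPos_four_singletons`), `m = 3` the dispatcher above, `m = 2` the generic two-slot cell,
`m ≤ 1` immediate. [this work] -/
theorem hereditaryMixture_four_of_canonCells (hc : ∀ k, CanonThreeSlotCells k) (h3 : OrThreeOfFourCell) (A : Fin 4 → Set α)
    (F : Fin 4 → Bool) (hA : HereditaryAllOrders μ A) (m : ℕ) (K : Fin m → Finset (Fin 4)) :
    BernsteinPos m (fun h => sahiE (coinWeight μ h) m (fun j => ind (⋂ i ∈ K j, orCoin (A i) (F i)))) := by
  refine bernsteinPos_sahiE_of_uncovered hμ hμ1 (fun L : Finset (Fin 4) => ⋂ i ∈ L, orCoin (A i) (F i)) (fun m K hunc => ?_) m K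
  have hirr : Irredundant K := Irredundant.of_uncovered _ K hunc
  have hm : m ≤ 4 := hirr.card_le
  have hsub : ∀ L : Finset (Fin 4), (⋂ i ∈ L, A i) ⊆ ⋂ i ∈ L.filter (fun i => F i = false), A i := fun L =>
    Set.biInter_subset_biInter_left (Finset.filter_subset _ L)
  have hcov : ∀ L L' : Finset (Fin 4), 0 ≤ ex μ (ind (⋂ i ∈ L, A i) * ind (⋂ i ∈ L', A i)) - ex μ (ind (⋂ i ∈ L, A i)) * ex μ (ind (⋂ i ∈ L', A i)) := by
    intro L L'
    have h2 := hA 2 ![L, L']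
    rw [sahiE_two_apply] at h2
    simp only [Matrix.cons_val_zero, Matrix.cons_val_one] at h2
    linarith
  interval_cases m
  · exact (bernsteinPos_const 0 le_rfl).congr fun h _ _ => by rw [sahiE_zero]
  · exact (bernsteinPos_ex_coinWeight hμ (fun x => ind_nonneg _ x)).congr fun h _ _ => by rw [sahiE_one_apply]
  · have e : (fun j => ind (⋂ i ∈ K j, orCoin (A i) (F i))) =
        ![ind (mixEv (⋂ i ∈ K 0, A i) (⋂ i ∈ (K 0).filter (fun i => F i = false), A i)),
          ind (mixEv (⋂ i ∈ K 1, A i) (⋂ i ∈ (K 1).filter (fun i => F i = false), A i))] := by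
      funext j; fin_cases j <;> simp [biInter_orCoin_eq_mixEv]
    simp only [e]
    exact bernsteinPos_two_mixEv hμ _ _ _ _ (hsub _) (hsub _) (hcov _ _) (hcov _ _)
  · exact bernsteinPos_threeSlot_of_canon hμ hμ1 hc A hA F K hirr
  · obtain ⟨σ, hσ⟩ := hirr.exists_perm_singleton
    have e : (fun j => ind (⋂ i ∈ K j, orCoin (A i) (F i))) = fun j => (fun i => ind (orCoin (A i) (F i))) (σ j) := by
      funext j; rw [hσ j, Finset.set_biInter_singleton]
    have key := bernsteinPos_four_singletons hμ hμ1 h3 A hA F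
    refine key.congr fun h _ _ => ?_
    rw [e, sahiE_comp_perm (coinWeight μ h) 4 σ (fun i => ind (orCoin (A i) (F i)))]

end Assembly

end SahiMixture

end Summit.CriticalPhenomena.PercolationContinuityZ3.Theorems

end
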